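import Summits.HodgeConjecture.HodgeConjecture.Theses.HeckePrymWeil
import Literature.AlgebraicGeometry.Motives.AbelianVarietyProjectiveChart

/-!
# `WeilTenfoldsSqrtMinus11` (crux `stmt-HodgeConjecture-1262`, route `HeckePrymWeil`):
# eigenvalue separation of the Weil-plane typing, its failure at `p = 3`, and summit-hardness of a refutation

Negative-side support file of the crux disprover (cdisprove seat
`refuter-cdisprove-stmt-HodgeConjecture-1262-0`, 2026-08-16). Everything is `sorry`-free.

The route types the complexified Weil plane `W_K ⊗ ℂ = ∧²ⁿH¹_σ ⊕ ∧²ⁿH¹_σ̄` of `(A, φ)`, `φ ≫ φ = -p`,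
as `Eig((𝟙 + φ)^*, (1 + i√p)²ⁿ) ⊔ Eig((𝟙 + φ)^*, (1 - i√p)²ⁿ)` inside `H²ⁿ(A(ℂ); ℂ)`. On the summand
`∧ᵃ V₊ ⊗ ∧ᵇ V₋` (`a + b = 2n`, `V_± = ker (φ^* ∓ i√p)`) the operator `(𝟙 + φ)^*` is the scalar
`(1 + i√p)ᵃ (1 - i√p)ᵇ`, so the typing is exact iff none of the MIXED products (`a b ≠ 0`) equals a
PURE one. Writing `(1 + t)ᵇ = x_b + y_b t` in `ℤ[t]`, `t² = -p` (`weilXY p b = (x_b, y_b)`), a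
collision with `b` conjugate factors happens iff `(1 - t)ᵇ = (1 + t)ᵇ` iff `y_b = 0`
(`one_sub_pow_eq_one_add_pow_iff`). Proved here:

* `weilXY_snd_ne_zero` — for every integer `p ≥ 2` with `1 + p` not a perfect square, `y_b ≠ 0` for
  all `b ≥ 1` (descent: `x_b² + p y_b² = (1+p)ᵇ`; `y_b = 0` with `b` odd makes `1 + p` a square, with
  `b = 2c` gives `x_c y_c = 0`, and `x_c = 0` gives `p ∣ (1+p)ᶜ`); `not_isSquare_one_add_of_prime` —
  for a prime `p` this is exactly `p ≠ 3`.
* `weil_mixed_ne_plus`, `weil_mixed_ne_minus`, `weil_plus_pow_ne_minus_pow` — for every prime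
  `p ≠ 3` and all exponents: `(1+i√p)ᵃ(1-i√p)ᵇ ≠ (1+i√p)ᵃ⁺ᵇ` (`b ≥ 1`), `≠ (1-i√p)ᵃ⁺ᵇ` (`a ≥ 1`),
  and `(1+i√p)ᵐ ≠ (1-i√p)ᵐ` (`m ≥ 1`) — the arithmetic behind the `7 ≤ p` items of the route
  (`HodgeWeilLadder`, `WeilDescending`: `λ = (1+i√p)²ⁿ ≠ λ̄`) and the three rungs; the instances
  `weil11_*` (`p = 11`, `2n = 10`, this crux) are spelled out literally.
* TIGHTNESS of the guard: `weil3_cube_collision : (1+i√3)³ = (1-i√3)³` and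
  `weil3_mixed_eq_plus : (1+i√3)³(1-i√3)³ = (1+i√3)⁶` — at `p = 3`, `2n = 6` (Schoen's `ℚ(√-3)`
  sixfolds) the single-operator eigenspace for `(1+i√3)⁶ = 64` also contains `∧³V₊ ⊗ ∧³V₋`, so the
  typing used by the route would NOT express the Weil plane there: the exclusion of `p = 3` is
  load-bearing for the statement's meaning (for primes, `p ≠ 3` is also sufficient).
* SUMMIT-HARDNESS of a refutation: `not_hodgeConjecture_of_not_weilTenfoldsSqrtMinus11 :
  ¬ WeilTenfoldsSqrtMinus11 → ¬ HodgeConjecture` (via the tree's proved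
  `AbelianVariety.isSmoothProjective_holds`): any disproof of the crux disproves the summit, hence
  (André 1996, barrier `Literature/Barriers/HodgeConjecture/MotivatedClassesAbelianVarieties`)
  Grothendieck's standard conjecture `B` for some abelian variety. The endomorphism hypothesis
  `φ ≫ φ = -11` and the Weil-plane hypothesis `c ∈ Eig₊ ⊔ Eig₋` are not used for this
  (`not_hodgeConjecture_of_exists_tenfold_counterexample`): they carry no refutation leverage.
-/

noncomputable section

namespace Summit.HodgeConjecture.HodgeConjecture.Theorems.WeilTenfoldsSqrtMinus11.Negative

open Complex

/-! ### Integer bookkeeping `(1 + t)ᵇ = x_b + y_b t`, `t² = -p` -/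

/-- `weilXY p b = (x_b, y_b)` with `(1 + t)ᵇ = x_b + y_b t` whenever `t² = -p`:
`(x₀, y₀) = (1, 0)`, `(x_{b+1}, y_{b+1}) = (x_b - p y_b, x_b + y_b)`. [folklore] -/
def weilXY (p : ℤ) : ℕ → ℤ × ℤ
  | 0 => (1, 0)
  | b + 1 => ((weilXY p b).1 - p * (weilXY p b).2, (weilXY p b).1 + (weilXY p b).2)

/-- `(1 + t)ᵇ = x_b + y_b t` for `t² = -p`. [folklore] -/
theorem one_add_pow_eq (p : ℤ) (t : ℂ) (ht : t ^ 2 = -(p : ℂ)) (b : ℕ) :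
    (1 + t) ^ b = ((weilXY p b).1 : ℂ) + ((weilXY p b).2 : ℂ) * t := by
  induction b with
  | zero => simp [weilXY]
  | succ b ih =>
    rw [pow_succ, ih]
    simp only [weilXY]
    push_cast
    linear_combination ((weilXY p b).2 : ℂ) * ht

/-- `(1 - t)ᵇ = x_b - y_b t` for `t² = -p` (conjugate of `one_add_pow_eq`). [folklore] -/
theorem one_sub_pow_eq (p : ℤ) (t : ℂ) (ht : t ^ 2 = -(p : ℂ)) (b : ℕ) :
    (1 - t) ^ b = ((weilXY p b).1 : ℂ) - ((weilXY p b).2 : ℂ) * t := by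
  have h := one_add_pow_eq p (-t) (by rw [neg_sq]; exact ht) b
  rw [sub_eq_add_neg, h]
  ring

/-- Collision criterion: `(1 - t)ᵇ = (1 + t)ᵇ` iff `y_b = 0` (`t ≠ 0`, `t² = -p`). [folklore] -/
theorem one_sub_pow_eq_one_add_pow_iff (p : ℤ) (t : ℂ) (ht : t ^ 2 = -(p : ℂ)) (ht0 : t ≠ 0)
    (b : ℕ) : (1 - t) ^ b = (1 + t) ^ b ↔ (weilXY p b).2 = 0 := by
  rw [one_add_pow_eq p t ht b, one_sub_pow_eq p t ht b]
  constructor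
  · intro h
    have h2 : (2 * ((weilXY p b).2 : ℂ)) * t = 0 := by linear_combination -h
    rcases mul_eq_zero.1 h2 with h3 | h3
    · exact_mod_cast (mul_eq_zero.1 h3).resolve_left two_ne_zero
    · exact absurd h3 ht0
  · intro h
    rw [h]
    push_cast
    ring

/-- Multiplicativity: `(x_{b+c}, y_{b+c}) = (x_b x_c - p y_b y_c, x_b y_c + y_b x_c)`. [folklore] -/
theorem weilXY_add (p : ℤ) (b c : ℕ) :
    weilXY p (b + c) = ((weilXY p b).1 * (weilXY p c).1 - p * (weilXY p b).2 * (weilXY p c).2,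
      (weilXY p b).1 * (weilXY p c).2 + (weilXY p b).2 * (weilXY p c).1) := by
  induction c with
  | zero => simp [weilXY]
  | succ c ih =>
    rw [Nat.add_succ]
    simp only [weilXY, ih]
    ext <;> ring

/-- Norm identity `x_b² + p y_b² = (1 + p)ᵇ`. [folklore] -/
theorem weilXY_norm (p : ℤ) (b : ℕ) :
    (weilXY p b).1 ^ 2 + p * (weilXY p b).2 ^ 2 = (1 + p) ^ b := by
  induction b with
  | zero => simp [weilXY]
  | succ b ih =>
    simp only [weilXY]
    linear_combination (1 + p) * ih

/-- For a prime `p ≠ 3`, `1 + p` is not a perfect square (`1 + p = m²` forces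
`p = (m-1)(m+1)`, so `m = 2`). [folklore] -/
theorem not_isSquare_one_add_of_prime {p : ℕ} (hp : p.Prime) (hp3 : p ≠ 3) :
    ¬ IsSquare (1 + p) := by
  rintro ⟨m, hm⟩
  have hm1 : 1 ≤ m := by
    rcases Nat.eq_zero_or_pos m with rfl | h
    · omega
    · exact h
  obtain ⟨k, rfl⟩ := Nat.exists_eq_add_of_le hm1
  -- `m = 1 + k`, `1 + p = (1 + k)²`, so `p = k (k + 2)`
  have hfac : k * (k + 2) = p := by
    have : (1 + k) * (1 + k) = 1 + k * (k + 2) := by ring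
    omega
  have hdvd : k ∣ p := ⟨k + 2, hfac.symm⟩
  rcases hp.eq_one_or_self_of_dvd k hdvd with h | h
  · subst h
    omega
  · subst h
    have hp0 : 0 < k := hp.pos
    have : k * (k + 2) = k * 1 := by omega
    have := Nat.eq_of_mul_eq_mul_left hp0 this
    omega

/-- Descent: for an integer `p ≥ 2` with `1 + p` not a perfect square, `y_b ≠ 0` for every `b ≥ 1`,
i.e. `(1 + i√p)ᵇ ∉ ℤ`: equivalently `(1 - i√p)/(1 + i√p)` is not a root of unity. [folklore] -/
theorem weilXY_snd_ne_zero {p : ℕ} (hp : 2 ≤ p) (hsq : ¬ IsSquare (1 + p)) :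
    ∀ b : ℕ, 1 ≤ b → (weilXY p b).2 ≠ 0 := by
  intro b
  induction b using Nat.strong_induction_on with
  | _ b ih =>
  intro hb hy
  rcases Nat.even_or_odd b with ⟨c, rfl⟩ | ⟨c, rfl⟩
  · -- even exponent `b = c + c`: `y_{2c} = 2 x_c y_c`
    have hc : 1 ≤ c := by omega
    have hy2 : (weilXY (p : ℤ) (c + c)).2 = 2 * (weilXY (p : ℤ) c).1 * (weilXY (p : ℤ) c).2 := by
      rw [weilXY_add]; ring
    rw [hy] at hy2
    rcases mul_eq_zero.1 hy2.symm with h | h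
    · rcases mul_eq_zero.1 h with h2 | hx
      · norm_num at h2
      · -- `x_c = 0`: the norm identity gives `p y_c² = (1+p)ᶜ`, so `p ∣ (1+p)ᶜ`, so `p` is a unit
        have hn := weilXY_norm (p : ℤ) c
        rw [hx] at hn
        have hdvd : (p : ℤ) ∣ (1 + (p : ℤ)) ^ c := ⟨(weilXY (p : ℤ) c).2 ^ 2, by rw [← hn]; ring⟩
        have hcop : IsCoprime (p : ℤ) ((1 + (p : ℤ)) ^ c) :=
          (show IsCoprime (p : ℤ) (1 + (p : ℤ)) from ⟨-1, 1, by ring⟩).pow_right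
        have hunit : IsUnit (p : ℤ) := hcop.isUnit_of_dvd' (dvd_refl _) hdvd
        rcases Int.isUnit_iff.1 hunit with h1 | h1 <;> omega
    · exact ih c (by omega) hc h
  · -- odd exponent `b = 2c + 1`: `x_b² = (1+p)^(2c) (1+p)` forces `1 + p` to be a square
    have hn := weilXY_norm (p : ℤ) (2 * c + 1)
    rw [hy] at hn
    have hn' : (weilXY (p : ℤ) (2 * c + 1)).1 ^ 2 = (1 + (p : ℤ)) ^ (2 * c + 1) := by
      rw [← hn]; ring
    set x := (weilXY (p : ℤ) (2 * c + 1)).1 with hx_def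
    set q : ℤ := (1 + (p : ℤ)) ^ c with hq_def
    have hq0 : q ≠ 0 := pow_ne_zero _ (by omega)
    have hxq : x ^ 2 = q ^ 2 * (1 + (p : ℤ)) := by rw [hn', hq_def]; ring
    have hdvd : q ∣ x := by
      have : q ^ 2 ∣ x ^ 2 := ⟨1 + (p : ℤ), hxq⟩
      exact (Int.pow_dvd_pow_iff two_ne_zero).1 this
    obtain ⟨k, hk0⟩ := hdvd
    have hk : k ^ 2 = 1 + (p : ℤ) := by
      have h2 : q ^ 2 * k ^ 2 = q ^ 2 * (1 + (p : ℤ)) := by rw [← hxq, hk0]; ring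
      exact mul_left_cancel₀ (pow_ne_zero 2 hq0) h2
    apply hsq
    refine ⟨k.natAbs, ?_⟩
    have : ((k.natAbs * k.natAbs : ℕ) : ℤ) = ((1 + p : ℕ) : ℤ) := by
      push_cast
      rw [abs_mul_abs_self, ← sq, hk]
    exact_mod_cast this.symm

/-! ### The complex numbers `1 ± i√p` -/

/-- `(i√p)² = -p`. [folklore] -/
theorem I_mul_sqrt_sq (p : ℕ) : (I * (Real.sqrt (p : ℝ) : ℂ)) ^ 2 = -((p : ℤ) : ℂ) := by
  rw [mul_pow, I_sq, ← Complex.ofReal_pow, Real.sq_sqrt (Nat.cast_nonneg p)]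
  push_cast
  ring

/-- `i√p ≠ 0` for `p > 0`. [folklore] -/
theorem I_mul_sqrt_ne_zero (p : ℕ) (hp : 0 < p) : (I * (Real.sqrt (p : ℝ) : ℂ)) ≠ 0 := by
  refine mul_ne_zero I_ne_zero ?_
  have : 0 < Real.sqrt (p : ℝ) := Real.sqrt_pos.2 (by exact_mod_cast hp)
  exact_mod_cast this.ne'

/-- `1 + i√p ≠ 0` (real part `1`). [folklore] -/
theorem one_add_I_mul_sqrt_ne_zero (p : ℕ) : (1 + I * (Real.sqrt (p : ℝ) : ℂ)) ≠ 0 := by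
  intro h
  have := congrArg Complex.re h
  simp at this

/-- `1 - i√p ≠ 0` (real part `1`). [folklore] -/
theorem one_sub_I_mul_sqrt_ne_zero (p : ℕ) : (1 - I * (Real.sqrt (p : ℝ) : ℂ)) ≠ 0 := by
  intro h
  have := congrArg Complex.re h
  simp at this

/-- If `y_b ≠ 0`, the mixed eigenvalue with `b` conjugate factors differs from the pure `+` one.
[folklore] -/
theorem mixed_ne_plus_of_snd_ne_zero (p : ℕ) (hp : 0 < p) (a b m : ℕ) (hab : a + b = m)
    (hy : (weilXY p b).2 ≠ 0) :
    (1 + I * (Real.sqrt (p : ℝ) : ℂ)) ^ a * (1 - I * (Real.sqrt (p : ℝ) : ℂ)) ^ b ≠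
      (1 + I * (Real.sqrt (p : ℝ) : ℂ)) ^ m := by
  set t : ℂ := I * (Real.sqrt (p : ℝ) : ℂ) with ht_def
  intro h
  have hsplit : (1 + t) ^ m = (1 + t) ^ a * (1 + t) ^ b := by rw [← pow_add, hab]
  have h1 : (1 + t) ^ a * ((1 - t) ^ b - (1 + t) ^ b) = 0 := by
    rw [mul_sub, h, hsplit, sub_self]
  rcases mul_eq_zero.1 h1 with h2 | h2
  · exact one_add_I_mul_sqrt_ne_zero p (pow_eq_zero_iff'.1 h2).1
  · exact hy ((one_sub_pow_eq_one_add_pow_iff p t (I_mul_sqrt_sq p) (I_mul_sqrt_ne_zero p hp) b).1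
      (sub_eq_zero.1 h2))

/-- If `y_a ≠ 0`, the mixed eigenvalue with `a` non-conjugate factors differs from the pure `-` one.
[folklore] -/
theorem mixed_ne_minus_of_snd_ne_zero (p : ℕ) (hp : 0 < p) (a b m : ℕ) (hab : a + b = m)
    (hy : (weilXY p a).2 ≠ 0) :
    (1 + I * (Real.sqrt (p : ℝ) : ℂ)) ^ a * (1 - I * (Real.sqrt (p : ℝ) : ℂ)) ^ b ≠
      (1 - I * (Real.sqrt (p : ℝ) : ℂ)) ^ m := by
  set t : ℂ := I * (Real.sqrt (p : ℝ) : ℂ) with ht_def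
  intro h
  have hsplit : (1 - t) ^ m = (1 - t) ^ a * (1 - t) ^ b := by rw [← pow_add, hab]
  have h1 : ((1 + t) ^ a - (1 - t) ^ a) * (1 - t) ^ b = 0 := by
    rw [sub_mul, h, hsplit, sub_self]
  rcases mul_eq_zero.1 h1 with h2 | h2
  · exact hy ((one_sub_pow_eq_one_add_pow_iff p t (I_mul_sqrt_sq p) (I_mul_sqrt_ne_zero p hp) a).1
      (sub_eq_zero.1 h2).symm)
  · exact one_sub_I_mul_sqrt_ne_zero p (pow_eq_zero_iff'.1 h2).1

/-! ### Separation for every prime `p ≠ 3` and all exponents -/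

/-- **Eigenvalue separation (all degrees).** For a prime `p ≠ 3` and `b ≥ 1`:
`(1 + i√p)ᵃ (1 - i√p)ᵇ ≠ (1 + i√p)ᵃ⁺ᵇ`. [folklore] -/
theorem weil_mixed_ne_plus {p : ℕ} (hp : p.Prime) (hp3 : p ≠ 3) {a b m : ℕ} (hab : a + b = m)
    (hb : 1 ≤ b) :
    (1 + I * (Real.sqrt (p : ℝ) : ℂ)) ^ a * (1 - I * (Real.sqrt (p : ℝ) : ℂ)) ^ b ≠
      (1 + I * (Real.sqrt (p : ℝ) : ℂ)) ^ m :=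
  mixed_ne_plus_of_snd_ne_zero p hp.pos a b m hab
    (weilXY_snd_ne_zero hp.two_le (not_isSquare_one_add_of_prime hp hp3) b hb)

/-- **Eigenvalue separation (all degrees).** For a prime `p ≠ 3` and `a ≥ 1`:
`(1 + i√p)ᵃ (1 - i√p)ᵇ ≠ (1 - i√p)ᵃ⁺ᵇ`. [folklore] -/
theorem weil_mixed_ne_minus {p : ℕ} (hp : p.Prime) (hp3 : p ≠ 3) {a b m : ℕ} (hab : a + b = m)
    (ha : 1 ≤ a) :
    (1 + I * (Real.sqrt (p : ℝ) : ℂ)) ^ a * (1 - I * (Real.sqrt (p : ℝ) : ℂ)) ^ b ≠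
      (1 - I * (Real.sqrt (p : ℝ) : ℂ)) ^ m :=
  mixed_ne_minus_of_snd_ne_zero p hp.pos a b m hab
    (weilXY_snd_ne_zero hp.two_le (not_isSquare_one_add_of_prime hp hp3) a ha)

/-- The two pure eigenvalues differ: `(1 + i√p)ᵐ ≠ (1 - i√p)ᵐ` for a prime `p ≠ 3`, `m ≥ 1`
(the `λ ≠ λ̄` used by `WeilDescending`). [folklore] -/
theorem weil_plus_pow_ne_minus_pow {p : ℕ} (hp : p.Prime) (hp3 : p ≠ 3) {m : ℕ} (hm : 1 ≤ m) :
    (1 + I * (Real.sqrt (p : ℝ) : ℂ)) ^ m ≠ (1 - I * (Real.sqrt (p : ℝ) : ℂ)) ^ m := by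
  have h := weil_mixed_ne_minus hp hp3 (a := m) (b := 0) (m := m) (by simp) hm
  simpa using h

/-! ### The instances of this crux: `p = 11`, `2n = 10` -/

/-- Certificate: `y_b(11) ≠ 0` for `1 ≤ b ≤ 10` by evaluation (`y = 1, 2, -8, -40, 16, 512, 832,
-4480, -18944, 15872`). [folklore] -/
theorem weilXY_eleven_snd_ne_zero : ∀ b ∈ Finset.Icc 1 10, (weilXY 11 b).2 ≠ 0 := by decide

/-- `p = 11`, `2n = 10`: no mixed eigenvalue equals `(1 + i√11)¹⁰`. [folklore] -/
theorem weil11_mixed_ne_plus (a b : ℕ) (hab : a + b = 10) (hb : 1 ≤ b) :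
    (1 + I * (Real.sqrt (11 : ℝ) : ℂ)) ^ a * (1 - I * (Real.sqrt (11 : ℝ) : ℂ)) ^ b ≠
      (1 + I * (Real.sqrt (11 : ℝ) : ℂ)) ^ 10 := by
  have h := weil_mixed_ne_plus (p := 11) (by norm_num) (by norm_num) hab hb
  exact_mod_cast h

/-- `p = 11`, `2n = 10`: no mixed eigenvalue equals `(1 - i√11)¹⁰`. [folklore] -/
theorem weil11_mixed_ne_minus (a b : ℕ) (hab : a + b = 10) (ha : 1 ≤ a) :
    (1 + I * (Real.sqrt (11 : ℝ) : ℂ)) ^ a * (1 - I * (Real.sqrt (11 : ℝ) : ℂ)) ^ b ≠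
      (1 - I * (Real.sqrt (11 : ℝ) : ℂ)) ^ 10 := by
  have h := weil_mixed_ne_minus (p := 11) (by norm_num) (by norm_num) hab ha
  exact_mod_cast h

/-- `p = 11`, `2n = 10`: the two Weil eigenvalues are distinct, so `Eig₊ ⊓ Eig₋ = 0` and the
decomposition `c = c₊ + c₋` of a Weil class is unique. [folklore] -/
theorem weil11_plus_ne_minus :
    (1 + I * (Real.sqrt (11 : ℝ) : ℂ)) ^ 10 ≠ (1 - I * (Real.sqrt (11 : ℝ) : ℂ)) ^ 10 := by
  have h := weil_plus_pow_ne_minus_pow (p := 11) (by norm_num) (by norm_num) (m := 10) (by norm_num)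
  exact_mod_cast h

/-! ### Tightness of the guard: the collision at `p = 3` -/

/-- `weilXY 3 3 = (-8, 0)`: `(1 + i√3)³ = -8 ∈ ℤ`. [folklore] -/
theorem weilXY_three_three : weilXY 3 3 = (-8, 0) := by decide

/-- **Collision at `p = 3`.** `(1 + i√3)³ = (1 - i√3)³` (`= -8`): `(1 - i√3)/(1 + i√3)` is a
primitive cube root of unity. [folklore] -/
theorem weil3_cube_collision :
    (1 + I * (Real.sqrt (3 : ℝ) : ℂ)) ^ 3 = (1 - I * (Real.sqrt (3 : ℝ) : ℂ)) ^ 3 := by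
  have h := (one_sub_pow_eq_one_add_pow_iff 3 (I * (Real.sqrt ((3 : ℕ) : ℝ) : ℂ))
    (I_mul_sqrt_sq 3) (I_mul_sqrt_ne_zero 3 (by norm_num)) 3).2 (by rw [weilXY_three_three])
  exact_mod_cast h.symm

/-- **The single-operator typing fails at `p = 3`, `2n = 6`.** The mixed `(3,3)` eigenvalue of
`(𝟙 + φ)^*` on `∧³V₊ ⊗ ∧³V₋ ⊆ H⁶` coincides with the pure one on `∧⁶V₊`:
`(1 + i√3)³ (1 - i√3)³ = (1 + i√3)⁶`. Hence for Schoen's `ℚ(√-3)` sixfolds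
`Eig((𝟙 + φ)^*, (1 + i√3)⁶)` is NOT the Weil line, and the route's restriction to `p ≠ 3`
(`7 ≤ p`) is load-bearing for the meaning of its statements. [folklore] -/
theorem weil3_mixed_eq_plus :
    (1 + I * (Real.sqrt (3 : ℝ) : ℂ)) ^ 3 * (1 - I * (Real.sqrt (3 : ℝ) : ℂ)) ^ 3 =
      (1 + I * (Real.sqrt (3 : ℝ) : ℂ)) ^ 6 := by
  rw [← weil3_cube_collision, ← pow_add]

/-! ### A refutation of the crux refutes the summit -/

open Literature.AlgebraicGeometry in
/-- **Summit-hardness.** `¬ WeilTenfoldsSqrtMinus11 → ¬ HodgeConjecture`: a tenfold `A` is smooth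
projective of dimension `A.dim = 10` (the tree's proved `AbelianVariety.isSmoothProjective_holds`),
so the summit applied to `A.X` at `p = 5` gives the crux's conclusion for every rational
`(5,5)`-class — the hypotheses `φ ≫ φ = -11` and `c ∈ Eig₊ ⊔ Eig₋` are not even used. Consequently
any counterexample to the crux is a non-algebraic Hodge class on a complex abelian variety, which by
André (1996, Thm. 0.6.2) refutes the standard conjecture of Lefschetz type
(`Literature.Barriers.HodgeConjecture.not_lefschetzStandardConjecture_of_counterexample`).
[cite: Andre1996Motifs, Thm. 0.6.2 and §6.3 Remarque 2] -/
theorem not_hodgeConjecture_of_not_weilTenfoldsSqrtMinus11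
    (h : ¬ Summit.HodgeConjecture.HodgeConjecture.Theses.HeckePrymWeil.WeilTenfoldsSqrtMinus11) :
    ¬ _root_.HodgeConjecture := by
  intro hHC
  apply h
  intro A φ hdim _hφ c hrat hhodge _hweil
  have hsp : Motives.IsSmoothProjective 10 A.X :=
    hdim ▸ (Motives.AbelianVariety.isSmoothProjective_holds (A := A))
  exact (hHC hsp).2 5 c hrat hhodge

open Literature.AlgebraicGeometry in
/-- The crux with BOTH the endomorphism hypothesis `φ ≫ φ = -11` and the Weil-plane hypothesis
`c ∈ Eig₊ ⊔ Eig₋` deleted — the Hodge conjecture in degree `10` for complex abelian tenfolds — is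
still a consequence of the summit; so neither hypothesis offers refutation leverage (dropping them
only makes the item HARDER to prove, never false unless the summit is). [cite: Deligne2000, §1] -/
theorem not_hodgeConjecture_of_exists_tenfold_counterexample
    (h : ∃ (A : Motives.AbelianVariety ℂ) (c : HodgeTheory.complexBetti A.X 10),
      A.dim = 10 ∧ HodgeTheory.IsRationalClass c ∧ HodgeTheory.IsOfHodgeType 10 A.X 10 5 5 c ∧
        c ∉ HodgeTheory.algebraicClasses A.X 5) :
    ¬ _root_.HodgeConjecture := by
  rintro hHC
  obtain ⟨A, c, hdim, hrat, hhodge, hc⟩ := h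
  have hsp : Motives.IsSmoothProjective 10 A.X :=
    hdim ▸ (Motives.AbelianVariety.isSmoothProjective_holds (A := A))
  exact hc ((hHC hsp).2 5 c hrat hhodge)

/-- Shape of a refutation (read-back): `¬ crux` is EXACTLY the existence of a tenfold `A`, an
endomorphism `φ` with `φ ≫ φ = -11`, and a rational `(5,5)`-class in the `(𝟙+φ)^*`-Weil plane
outside `algebraicClasses A.X 5`. [folklore] -/
theorem not_weilTenfoldsSqrtMinus11_iff :
    ¬ Summit.HodgeConjecture.HodgeConjecture.Theses.HeckePrymWeil.WeilTenfoldsSqrtMinus11 ↔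
      ∃ (A : Literature.AlgebraicGeometry.Motives.AbelianVariety ℂ) (φ : A ⟶ A)
        (c : Literature.AlgebraicGeometry.HodgeTheory.complexBetti A.X 10),
        A.dim = 10 ∧
        CategoryTheory.CategoryStruct.comp φ φ = -((11 : ℤ) • CategoryTheory.CategoryStruct.id A) ∧
        Literature.AlgebraicGeometry.HodgeTheory.IsRationalClass c ∧
        Literature.AlgebraicGeometry.HodgeTheory.IsOfHodgeType 10 A.X 10 5 5 c ∧
        c ∈ Module.End.eigenspace (Literature.AlgebraicGeometry.HodgeTheory.complexBetti.map
              (CategoryTheory.CategoryStruct.id A + φ).hom.hom.hom 10).hom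
              ((1 + Complex.I * (Real.sqrt (11 : ℝ) : ℂ)) ^ 10) ⊔
            Module.End.eigenspace (Literature.AlgebraicGeometry.HodgeTheory.complexBetti.map
              (CategoryTheory.CategoryStruct.id A + φ).hom.hom.hom 10).hom
              ((1 - Complex.I * (Real.sqrt (11 : ℝ) : ℂ)) ^ 10) ∧
        c ∉ Literature.AlgebraicGeometry.HodgeTheory.algebraicClasses A.X 5 := by
  unfold Summit.HodgeConjecture.HodgeConjecture.Theses.HeckePrymWeil.WeilTenfoldsSqrtMinus11
  push Not
  constructor
  · rintro ⟨A, φ, hdim, hφ, c, hrat, hhodge, hweil, hc⟩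
    exact ⟨A, φ, c, hdim, hφ, hrat, hhodge, hweil, hc⟩
  · rintro ⟨A, φ, c, hdim, hφ, hrat, hhodge, hweil, hc⟩
    exact ⟨A, φ, hdim, hφ, c, hrat, hhodge, hweil, hc⟩

/-- Any refutation of the crux lands in the summit-hard shape of
`not_hodgeConjecture_of_exists_tenfold_counterexample` (forget `φ` and the Weil-plane
condition). [folklore] -/
theorem exists_tenfold_counterexample_of_not
    (h : ¬ Summit.HodgeConjecture.HodgeConjecture.Theses.HeckePrymWeil.WeilTenfoldsSqrtMinus11) :
    ∃ (A : Literature.AlgebraicGeometry.Motives.AbelianVariety ℂ)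
      (c : Literature.AlgebraicGeometry.HodgeTheory.complexBetti A.X 10),
      A.dim = 10 ∧ Literature.AlgebraicGeometry.HodgeTheory.IsRationalClass c ∧
        Literature.AlgebraicGeometry.HodgeTheory.IsOfHodgeType 10 A.X 10 5 5 c ∧
        c ∉ Literature.AlgebraicGeometry.HodgeTheory.algebraicClasses A.X 5 := by
  obtain ⟨A, φ, c, hdim, -, hrat, hhodge, -, hc⟩ := not_weilTenfoldsSqrtMinus11_iff.1 h
  exact ⟨A, c, hdim, hrat, hhodge, hc⟩

end Summit.HodgeConjecture.HodgeConjecture.Theorems.WeilTenfoldsSqrtMinus11.Negative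

end
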